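import Literature.IUT.HodgeArakelov.AbsTopMonoidsGenuineRmk181Holds
import Literature.IUT.HodgeArakelov.AbsTopMonoidsGenuineIsometriesOfSetting
import HarnessLib

/-!
# [IUTchII] Remark 1.8.1 at the GENUINE setting over `(K, ℚ̄_p, ε = id)` (proof-only corollary)

S. Mochizuki, *Inter-universal Teichmüller theory II*, §1, Remark 1.8.1, kurims manuscript (Dec. 2020) pp. 41–42
[claim: Mochizuki2012, status: disputed] (IUTchII §1 Rmk 1.8.1, kurims pp.41-42).  abc-iut cell, layer L6, NV register
row «AbsTopMonoids at the genuine setting»; seat abc-iut-L6-d2 (gen 5).  The unconditional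
`AbsTopMonoids.rmk181_genuineOfModelIsm` (p433590; abc-iut-w6-d012's `MLFClosure.norm_liftM_eq` holds for EVERY closure
datum) specialised to abc-iut-w5-d233's genuine-setting data (`AbsTopMonoidsGenuineOfSettingPadicClosure.lean`, p431000:
`S = ThetaSetting.ofDoubleUnderline …`, closure `(K, ℚ̄_p)`, choice-free `ε = galoisEpsilonPadic`), next to this seat's
`exists_allGenuine_ofDoubleUnderlinePadic` (p431329):

* `AbsTopMonoids.exists_allGenuine_rmk181_ofDoubleUnderlinePadic(_of_isOpenMap)` — at the genuine setting, under (H1)/(H2)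
  (resp. «`Π^tp_X → G_K` open»), there is an ALL-FIELDS-GENUINE `AbsTopMonoids` (`O^⊳(G) = 𝒪^⊳_{ℚ̄_p}`, `Ism(G)` = print's
  isometry group) for which Remark 1.8.1 (`Rmk181_statement`) HOLDS.

HONEST FRAMING: record-only under a disputed claim key; nothing here bears on [IUTchIII] Cor. 3.12; typed ≠ proved
elsewhere.
-/

set_option autoImplicit false

noncomputable section

namespace Literature.IUT.HodgeArakelov

open CategoryTheory
open Literature.AnabelianGeometry.AbsoluteAnabelian
open Literature.AnabelianGeometry.EtaleTheta Literature.AnabelianGeometry.SemiGraphs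
open scoped Literature.AnabelianGeometry.EtaleTheta

namespace AbsTopMonoids

variable {p : ℕ} [Fact p.Prime] {D : Literature.AnabelianGeometry.EtaleTheta.ThetaSetting p}
  {ED : D.EtaleThetaData} {l : ℕ} (C : ED.DoubleUnderline l) {N : ℕ+} (μ : D.CyclotomeMod l N)
  (hC : D.Compat) (hS : D.Sec2Hyps) (hl : l.Prime) (hp2 : p ≠ 2) (hpl : p ≠ l)
  (hζ : ∃ ζ : D.K, IsPrimitiveRoot ζ (4 * l)) {η : (C.thetaEnvData μ hC hS).PiYdd → MuN p N}
  (hη : η ∈ (C.thetaEnvData μ hC hS).thetaCocycles)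

/-- **Remark 1.8.1 at the genuine setting over `(K, ℚ̄_p, ε = id)`**: under (H1) `hΔ` and (H2) `hq` there is an
all-fields-genuine `AbsTopMonoids` at `S = ofDoubleUnderline C μ …` — `O^⊳(G) = 𝒪^⊳_{ℚ̄_p}`, `Ism(G)` = print's isometry
group — satisfying `Rmk181_statement` (namely `genuineOfModelIsm` at abc-iut-w5-d233's data).
[claim: Mochizuki2012, status: disputed] (IUTchII §1 Rmk 1.8.1, kurims pp.41-42) -/
theorem exists_allGenuine_rmk181_ofDoubleUnderlinePadic
    (hΔ : ∀ f : (ThetaSetting.ofDoubleUnderline C μ hC hS hl hp2 hpl hζ hη).PiX ≃ₜ*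
        (ThetaSetting.ofDoubleUnderline C μ hC hS hl hp2 hpl hζ hη).PiX,
      (ThetaSetting.ofDoubleUnderline C μ hC hS hl hp2 hpl hζ hη).DeltaX.map f.toMulEquiv.toMonoidHom =
        (ThetaSetting.ofDoubleUnderline C μ hC hS hl hp2 hpl hζ hη).DeltaX)
    (hq : Nonempty (TopGroup.quot (ThetaSetting.ofDoubleUnderline C μ hC hS hl hp2 hpl hζ hη).PiX
        (ThetaSetting.ofDoubleUnderline C μ hC hS hl hp2 hpl hζ hη).DeltaX ≃ₜ*
        (ThetaSetting.ofDoubleUnderline C μ hC hS hl hp2 hpl hζ hη).Gk)) :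
    ∃ A : AbsTopMonoids (ThetaSetting.ofDoubleUnderline C μ hC hS hl hp2 hpl hζ hη),
      (∀ G, A.Otri G =
        (ModelMLFGaloisData.galois D.toTemperedCurve.mlfClosurePadic.k D.toTemperedCurve.mlfClosurePadic.K).tmPair.M) ∧
      (∀ G, A.Ism G = ↥(A.ism G)) ∧ Rmk181_statement A :=
  ⟨genuineOfModelIsm (ThetaSetting.ofDoubleUnderline C μ hC hS hl hp2 hpl hζ hη) D.toTemperedCurve.mlfClosurePadic
      D.toTemperedCurve.galoisEpsilonPadic hΔ hq,
    fun _ => rfl, fun _ => rfl, rmk181_genuineOfModelIsm _ _ _ hΔ hq⟩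

/-- **The same with (H2) from «`Π^tp_X → G_K` open»**. [claim: Mochizuki2012, status: disputed] (IUTchII §1 Rmk 1.8.1, kurims pp.41-42) -/
theorem exists_allGenuine_rmk181_ofDoubleUnderlinePadic_of_isOpenMap
    (hopen : IsOpenMap fun x : D.PiTemp => (⟨D.aug x, D.aug_mem_GK x⟩ : D.GK))
    (hΔ : ∀ f : (ThetaSetting.ofDoubleUnderline C μ hC hS hl hp2 hpl hζ hη).PiX ≃ₜ*
        (ThetaSetting.ofDoubleUnderline C μ hC hS hl hp2 hpl hζ hη).PiX,
      (ThetaSetting.ofDoubleUnderline C μ hC hS hl hp2 hpl hζ hη).DeltaX.map f.toMulEquiv.toMonoidHom =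
        (ThetaSetting.ofDoubleUnderline C μ hC hS hl hp2 hpl hζ hη).DeltaX) :
    ∃ A : AbsTopMonoids (ThetaSetting.ofDoubleUnderline C μ hC hS hl hp2 hpl hζ hη),
      (∀ G, A.Otri G =
        (ModelMLFGaloisData.galois D.toTemperedCurve.mlfClosurePadic.k D.toTemperedCurve.mlfClosurePadic.K).tmPair.M) ∧
      (∀ G, A.Ism G = ↥(A.ism G)) ∧ Rmk181_statement A :=
  exists_allGenuine_rmk181_ofDoubleUnderlinePadic C μ hC hS hl hp2 hpl hζ hη hΔ
    (quotDeltaX_iso_of_isOpenMap _ (hopen.comp C.isOpen_Huu.isOpenMap_subtype_val))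

end AbsTopMonoids

end Literature.IUT.HodgeArakelov

end
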